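import Mathlib.Algebra.Homology.DerivedCategory.Ext.ExtClass
import Mathlib.CategoryTheory.Abelian.Refinements
import HarnessLib

/-!
# The two composite connecting `Ext`-classes of a `3 × 3` diagram anticommute

Let `C` be an abelian category and
```
R₁ :  A₁ ⟶ B₁ ⟶ C₁
      ↓    ↓    ↓      φ
R₂ :  A₂ ⟶ B₂ ⟶ C₂
      ↓    ↓    ↓      ψ
R₃ :  A₃ ⟶ B₃ ⟶ C₃
```
a commutative diagram (two morphisms of short complexes `φ : R₁ ⟶ R₂`, `ψ : R₂ ⟶ R₃` with
`φ ≫ ψ = 0`) whose three rows `R₁, R₂, R₃` and whose outer columns `col₁ : A₁ ⟶ A₂ ⟶ A₃`,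
`col₃ : C₁ ⟶ C₂ ⟶ C₃` are short exact. Writing `[S] ∈ Ext¹(S.X₃, S.X₁)` for Mathlib's
`ShortComplex.ShortExact.extClass` (the class of a short exact sequence in Mathlib's
derived-category `Ext`, `CategoryTheory.Abelian.Ext`; Mathlib's `Ext.comp` is diagrammatic:
`α.comp β` is «`α` then `β`»), the results are

* `NineDiagram.col₂_exact` : the middle column `col₂ : B₁ ⟶ B₂ ⟶ B₃` is exact at `B₂`
  (the `3 × 3` lemma, middle case);
* `NineDiagram.extClass_comp_extClass_add_eq_zero` :
  `[col₃] ∘ [R₁] + [R₃] ∘ [col₁] = 0` in `Ext²(C₃, A₁)`,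
  i.e. the two composite connecting classes `C₃ ⇝ C₁ ⇝ A₁` and `C₃ ⇝ A₃ ⇝ A₁` **differ in sign**
  (`NineDiagram.extClass_comp_extClass_eq_neg`, `…_eq_units_smul`). This is the `Ext`-class form
  of Cartan–Eilenberg's anticommutativity of the two iterated connecting homomorphisms of such a
  diagram (stated there for any connected sequence of functors; the proof below is theirs, in
  Yoneda form). The relation does not depend on the sign convention chosen for `extClass` (both
  products change sign twice), and it is stated in every degree `n` with `1 + 1 = n` so that it
  rewrites under either spelling of `Ext²`.

PROOF (all auxiliary declarations are `private`). §1: put `D := B₂ ⧸ A₁` (cokernel of the mono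
`A₁ ⟶ A₂ ⟶ B₂`) and `K := ker (D ⟶ C₃)`. The maps `C₁ = B₁ ⧸ A₁ ⟶ D` and `A₃ = A₂ ⧸ A₁ ⟶ D` land
in `K` (`j₁, j₃`), the maps `D ⟶ C₂`, `D ⟶ B₃` restrict to `p₁ : K ⟶ C₁`, `p₃ : K ⟶ A₃`, and these
four maps exhibit `K ≅ C₁ ⊞ A₃` (`ext_K`, a diagram chase by refinements — Mathlib
`CategoryTheory.Abelian.Refinements` — and `id_K`). §2: naturality of `extClass` (Mathlib
`extClass_naturality`) along the four evident morphisms of short exact sequences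
`R₁ ⟶ (A₁ ↪ B₂ ↠ D) ⟵ col₁` and `col₃ ⟵ (K ↪ D ↠ C₃) ⟶ R₃` identifies
`e₁^*[A₁ ↪ B₂ ↠ D] = [R₁]`, `e₃^*[A₁ ↪ B₂ ↠ D] = [col₁]`, `(p₁)_*[K ↪ D ↠ C₃] = [col₃]`,
`(p₃)_*[K ↪ D ↠ C₃] = [R₃]`; finally `[K ↪ D ↠ C₃]` followed by `K ↪ D` is zero (Mathlib
`extClass_comp`), and expanding `K ↪ D = p₁ ≫ e₁ + p₃ ≫ e₃` gives the relation.

No instance, no notation, no named fact (`def … : Prop`); Mathlib-only imports. Written for the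
venture `HSemireg` (cell `pub-hsemireg`, seat s4-prove-1 g28, 2026-08-28) as the generic algebra
behind the square «`[S] ∘ At(E₊) = −At(E) ∘ [𝓗om(𝒯, S)]`» of the Atiyah class along a short exact
sequence `S` (the theorem applied to the three Atiyah∕jet sequences of `E₊, E₋, E` as rows; that
application is NOT in this file, which mentions no variety, sheaf or Atiyah class).

## References

* H. Cartan, S. Eilenberg, *Homological Algebra*, Princeton Math. Series 19 (1956), Ch. III §4,
  Prop. 4.1, pp. 44–45 (anticommutativity of the two composite connecting homomorphisms of a
  commutative `3 × 3` diagram with exact rows and columns). [CartanEilenberg1956]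
* C. Weibel, *An introduction to homological algebra*, CUP (1994), Exercise 1.3.2 (3), p. 11
  (the `3 × 3` lemma, middle row∕column). [Weibel1994]
-/

universe w v u

open CategoryTheory CategoryTheory.Limits CategoryTheory.Abelian

namespace Literature.Algebra.Homology

namespace NineDiagram

variable {C : Type u} [Category.{v} C] [Abelian C]
variable {R₁ R₂ R₃ : ShortComplex C} (φ : R₁ ⟶ R₂) (ψ : R₂ ⟶ R₃)

/-! ## §0 The columns -/

/-- The first column `A₁ ⟶ A₂ ⟶ A₃` of the diagram (a complex because `φ ≫ ψ = 0`). [folklore] -/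
abbrev col₁ (w : φ ≫ ψ = 0) : ShortComplex C :=
  ShortComplex.mk φ.τ₁ ψ.τ₁ (by rw [← ShortComplex.comp_τ₁, w, ShortComplex.zero_τ₁])

/-- The middle column `B₁ ⟶ B₂ ⟶ B₃` of the diagram. [folklore] -/
abbrev col₂ (w : φ ≫ ψ = 0) : ShortComplex C :=
  ShortComplex.mk φ.τ₂ ψ.τ₂ (by rw [← ShortComplex.comp_τ₂, w, ShortComplex.zero_τ₂])

/-- The last column `C₁ ⟶ C₂ ⟶ C₃` of the diagram. [folklore] -/
abbrev col₃ (w : φ ≫ ψ = 0) : ShortComplex C :=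
  ShortComplex.mk φ.τ₃ ψ.τ₃ (by rw [← ShortComplex.comp_τ₃, w, ShortComplex.zero_τ₃])

/-! ## §1 The auxiliary objects `D = B₂ ⧸ A₁`, `K = ker (D ⟶ C₃)` and `K ≅ C₁ ⊞ A₃` -/

/-- The diagonal `A₁ ⟶ B₂` (`= A₁ ⟶ A₂ ⟶ B₂ = A₁ ⟶ B₁ ⟶ B₂`). [folklore] -/
private abbrev diag : R₁.X₁ ⟶ R₂.X₂ := φ.τ₁ ≫ R₂.f

/-- `D := B₂ ⧸ A₁`, the cokernel of the diagonal. [folklore] -/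
private noncomputable abbrev D : C := cokernel (diag φ)

/-- The projection `B₂ ⟶ D`. [folklore] -/
private noncomputable abbrev πD : R₂.X₂ ⟶ D φ := cokernel.π (diag φ)

/-- `A₁ ⟶ A₂ ⟶ B₂ ⟶ D` vanishes. [folklore] -/
@[reassoc]
private theorem diag_πD : φ.τ₁ ≫ R₂.f ≫ πD φ = 0 := by
  rw [← Category.assoc]
  exact cokernel.condition _

/-- `q : D ⟶ C₃`, induced by `B₂ ⟶ C₂ ⟶ C₃`. [folklore] -/
private noncomputable def q : D φ ⟶ R₃.X₃ :=
  cokernel.desc (diag φ) (R₂.g ≫ ψ.τ₃) (by rw [Category.assoc, R₂.zero_assoc, zero_comp, comp_zero])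

/-- `d₂ : D ⟶ C₂`, induced by `B₂ ⟶ C₂`. [folklore] -/
private noncomputable def d₂ : D φ ⟶ R₂.X₃ :=
  cokernel.desc (diag φ) R₂.g (by rw [Category.assoc, R₂.zero, comp_zero])

/-- `A₁ ⟶ B₂ ⟶ B₃` vanishes (it equals `A₁ ⟶ A₂ ⟶ A₃ ⟶ B₃`). [folklore] -/
private theorem diag_comp_τ₂ (w : φ ≫ ψ = 0) : diag φ ≫ ψ.τ₂ = 0 := by
  rw [Category.assoc, ← ψ.comm₁₂, ← Category.assoc, ← ShortComplex.comp_τ₁, w,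
    ShortComplex.zero_τ₁, zero_comp]

/-- `d₃ : D ⟶ B₃`, induced by `B₂ ⟶ B₃`. [folklore] -/
private noncomputable def d₃ (w : φ ≫ ψ = 0) : D φ ⟶ R₃.X₂ :=
  cokernel.desc (diag φ) ψ.τ₂ (diag_comp_τ₂ φ ψ w)

/-- `B₂ ⟶ D ⟶ C₃ = B₂ ⟶ C₂ ⟶ C₃`. [folklore] -/
@[reassoc]
private theorem πD_q : πD φ ≫ q φ ψ = R₂.g ≫ ψ.τ₃ :=
  cokernel.π_desc _ _ _

/-- `B₂ ⟶ D ⟶ C₂ = B₂ ⟶ C₂`. [folklore] -/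
@[reassoc]
private theorem πD_d₂ : πD φ ≫ d₂ φ = R₂.g :=
  cokernel.π_desc _ _ _

/-- `B₂ ⟶ D ⟶ B₃ = B₂ ⟶ B₃`. [folklore] -/
@[reassoc]
private theorem πD_d₃ (w : φ ≫ ψ = 0) : πD φ ≫ d₃ φ ψ w = ψ.τ₂ :=
  cokernel.π_desc _ _ _

/-- `D ⟶ C₂ ⟶ C₃ = D ⟶ C₃`. [folklore] -/
@[reassoc]
private theorem d₂_comp : d₂ φ ≫ ψ.τ₃ = q φ ψ := by
  rw [← cancel_epi (πD φ), πD_d₂_assoc, πD_q]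

/-- `D ⟶ B₃ ⟶ C₃ = D ⟶ C₃`. [folklore] -/
@[reassoc]
private theorem d₃_comp (w : φ ≫ ψ = 0) : d₃ φ ψ w ≫ R₃.g = q φ ψ := by
  rw [← cancel_epi (πD φ), πD_d₃_assoc, πD_q, ψ.comm₂₃]

/-- `K := ker (D ⟶ C₃)`. [folklore] -/
private noncomputable abbrev K : C := kernel (q φ ψ)

/-- The inclusion `K ⟶ D`. [folklore] -/
private noncomputable abbrev ιK : K φ ψ ⟶ D φ := kernel.ι (q φ ψ)

/-- `p₁ : K ⟶ C₁`, the restriction of `D ⟶ C₂` (`C₁ = ker (C₂ ⟶ C₃)`). [folklore] -/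
private noncomputable def p₁ (w : φ ≫ ψ = 0) (hC₃ : (col₃ φ ψ w).ShortExact) : K φ ψ ⟶ R₁.X₃ :=
  have : Mono φ.τ₃ := hC₃.mono_f
  hC₃.exact.lift (ιK φ ψ ≫ d₂ φ) (by rw [Category.assoc, d₂_comp, kernel.condition])

/-- `p₃ : K ⟶ A₃`, the restriction of `D ⟶ B₃` (`A₃ = ker (B₃ ⟶ C₃)`). [folklore] -/
private noncomputable def p₃ (w : φ ≫ ψ = 0) (hR₃ : R₃.ShortExact) : K φ ψ ⟶ R₃.X₁ :=
  have : Mono R₃.f := hR₃.mono_f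
  hR₃.exact.lift (ιK φ ψ ≫ d₃ φ ψ w) (by rw [Category.assoc, d₃_comp, kernel.condition])

/-- `K ⟶ C₁ ⟶ C₂ = K ⟶ D ⟶ C₂`. [folklore] -/
@[reassoc]
private theorem p₁_comp (w : φ ≫ ψ = 0) (hC₃ : (col₃ φ ψ w).ShortExact) :
    p₁ φ ψ w hC₃ ≫ φ.τ₃ = ιK φ ψ ≫ d₂ φ :=
  have : Mono φ.τ₃ := hC₃.mono_f
  hC₃.exact.lift_f _ _

/-- `K ⟶ A₃ ⟶ B₃ = K ⟶ D ⟶ B₃`. [folklore] -/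
@[reassoc]
private theorem p₃_comp (w : φ ≫ ψ = 0) (hR₃ : R₃.ShortExact) :
    p₃ φ ψ w hR₃ ≫ R₃.f = ιK φ ψ ≫ d₃ φ ψ w :=
  have : Mono R₃.f := hR₃.mono_f
  hR₃.exact.lift_f _ _

/-- `e₁ : C₁ ⟶ D`, induced by `B₁ ⟶ B₂ ⟶ D` (`C₁ = B₁ ⧸ A₁`). [folklore] -/
private noncomputable def e₁ (hR₁ : R₁.ShortExact) : R₁.X₃ ⟶ D φ :=
  have : Epi R₁.g := hR₁.epi_g
  hR₁.exact.desc (φ.τ₂ ≫ πD φ) (by rw [← φ.comm₁₂_assoc]; exact diag_πD φ)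

/-- `e₃ : A₃ ⟶ D`, induced by `A₂ ⟶ B₂ ⟶ D` (`A₃ = A₂ ⧸ A₁`). [folklore] -/
private noncomputable def e₃ (w : φ ≫ ψ = 0) (hC₁ : (col₁ φ ψ w).ShortExact) : R₃.X₁ ⟶ D φ :=
  have : Epi ψ.τ₁ := hC₁.epi_g
  hC₁.exact.desc (R₂.f ≫ πD φ) (diag_πD φ)

/-- `B₁ ⟶ C₁ ⟶ D = B₁ ⟶ B₂ ⟶ D`. [folklore] -/
@[reassoc]
private theorem comp_e₁ (hR₁ : R₁.ShortExact) : R₁.g ≫ e₁ φ hR₁ = φ.τ₂ ≫ πD φ :=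
  have : Epi R₁.g := hR₁.epi_g
  hR₁.exact.g_desc _ _

/-- `A₂ ⟶ A₃ ⟶ D = A₂ ⟶ B₂ ⟶ D`. [folklore] -/
@[reassoc]
private theorem comp_e₃ (w : φ ≫ ψ = 0) (hC₁ : (col₁ φ ψ w).ShortExact) :
    ψ.τ₁ ≫ e₃ φ ψ w hC₁ = R₂.f ≫ πD φ :=
  have : Epi ψ.τ₁ := hC₁.epi_g
  hC₁.exact.g_desc _ _

/-- `C₁ ⟶ D ⟶ C₂` is the given mono `C₁ ⟶ C₂`. [folklore] -/
@[reassoc]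
private theorem e₁_d₂ (hR₁ : R₁.ShortExact) : e₁ φ hR₁ ≫ d₂ φ = φ.τ₃ := by
  have : Epi R₁.g := hR₁.epi_g
  rw [← cancel_epi R₁.g, comp_e₁_assoc, πD_d₂, φ.comm₂₃]

/-- `A₃ ⟶ D ⟶ B₃` is the given mono `A₃ ⟶ B₃`. [folklore] -/
@[reassoc]
private theorem e₃_d₃ (w : φ ≫ ψ = 0) (hC₁ : (col₁ φ ψ w).ShortExact) :
    e₃ φ ψ w hC₁ ≫ d₃ φ ψ w = R₃.f := by
  have : Epi ψ.τ₁ := hC₁.epi_g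
  rw [← cancel_epi ψ.τ₁, comp_e₃_assoc, πD_d₃, ψ.comm₁₂]

/-- `C₁ ⟶ D ⟶ B₃ = 0`. [folklore] -/
@[reassoc]
private theorem e₁_d₃ (w : φ ≫ ψ = 0) (hR₁ : R₁.ShortExact) : e₁ φ hR₁ ≫ d₃ φ ψ w = 0 := by
  have : Epi R₁.g := hR₁.epi_g
  rw [← cancel_epi R₁.g, comp_e₁_assoc, πD_d₃, comp_zero, ← ShortComplex.comp_τ₂, w,
    ShortComplex.zero_τ₂]

/-- `A₃ ⟶ D ⟶ C₂ = 0`. [folklore] -/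
@[reassoc]
private theorem e₃_d₂ (w : φ ≫ ψ = 0) (hC₁ : (col₁ φ ψ w).ShortExact) : e₃ φ ψ w hC₁ ≫ d₂ φ = 0 := by
  have : Epi ψ.τ₁ := hC₁.epi_g
  rw [← cancel_epi ψ.τ₁, comp_e₃_assoc, πD_d₂, R₂.zero, comp_zero]

/-- `C₁ ⟶ D ⟶ C₃ = 0`. [folklore] -/
@[reassoc]
private theorem e₁_q (w : φ ≫ ψ = 0) (hR₁ : R₁.ShortExact) : e₁ φ hR₁ ≫ q φ ψ = 0 := by
  rw [← d₂_comp, e₁_d₂_assoc, ← ShortComplex.comp_τ₃, w, ShortComplex.zero_τ₃]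

/-- `A₃ ⟶ D ⟶ C₃ = 0`. [folklore] -/
@[reassoc]
private theorem e₃_q (w : φ ≫ ψ = 0) (hC₁ : (col₁ φ ψ w).ShortExact) : e₃ φ ψ w hC₁ ≫ q φ ψ = 0 := by
  rw [← d₂_comp, e₃_d₂_assoc, zero_comp]

/-- `j₁ : C₁ ⟶ K`, the corestriction of `e₁`. [folklore] -/
private noncomputable def j₁ (w : φ ≫ ψ = 0) (hR₁ : R₁.ShortExact) : R₁.X₃ ⟶ K φ ψ :=
  kernel.lift (q φ ψ) (e₁ φ hR₁) (e₁_q φ ψ w hR₁)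

/-- `j₃ : A₃ ⟶ K`, the corestriction of `e₃`. [folklore] -/
private noncomputable def j₃ (w : φ ≫ ψ = 0) (hC₁ : (col₁ φ ψ w).ShortExact) : R₃.X₁ ⟶ K φ ψ :=
  kernel.lift (q φ ψ) (e₃ φ ψ w hC₁) (e₃_q φ ψ w hC₁)

/-- `C₁ ⟶ K ⟶ D = e₁`. [folklore] -/
@[reassoc]
private theorem j₁_ιK (w : φ ≫ ψ = 0) (hR₁ : R₁.ShortExact) : j₁ φ ψ w hR₁ ≫ ιK φ ψ = e₁ φ hR₁ :=
  kernel.lift_ι _ _ _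

/-- `A₃ ⟶ K ⟶ D = e₃`. [folklore] -/
@[reassoc]
private theorem j₃_ιK (w : φ ≫ ψ = 0) (hC₁ : (col₁ φ ψ w).ShortExact) :
    j₃ φ ψ w hC₁ ≫ ιK φ ψ = e₃ φ ψ w hC₁ :=
  kernel.lift_ι _ _ _

/-- `C₁ ⟶ K ⟶ C₁ = 𝟙`. [folklore] -/
private theorem j₁_p₁ (w : φ ≫ ψ = 0) (hR₁ : R₁.ShortExact) (hC₃ : (col₃ φ ψ w).ShortExact) :
    j₁ φ ψ w hR₁ ≫ p₁ φ ψ w hC₃ = 𝟙 _ := by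
  have : Mono φ.τ₃ := hC₃.mono_f
  rw [← cancel_mono φ.τ₃, Category.assoc, p₁_comp, j₁_ιK_assoc, e₁_d₂, Category.id_comp]

/-- `A₃ ⟶ K ⟶ A₃ = 𝟙`. [folklore] -/
private theorem j₃_p₃ (w : φ ≫ ψ = 0) (hR₃ : R₃.ShortExact) (hC₁ : (col₁ φ ψ w).ShortExact) :
    j₃ φ ψ w hC₁ ≫ p₃ φ ψ w hR₃ = 𝟙 _ := by
  have : Mono R₃.f := hR₃.mono_f
  rw [← cancel_mono R₃.f, Category.assoc, p₃_comp, j₃_ιK_assoc, e₃_d₃, Category.id_comp]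

/-- `A₃ ⟶ K ⟶ C₁ = 0`. [folklore] -/
private theorem j₃_p₁ (w : φ ≫ ψ = 0) (hC₁ : (col₁ φ ψ w).ShortExact) (hC₃ : (col₃ φ ψ w).ShortExact) :
    j₃ φ ψ w hC₁ ≫ p₁ φ ψ w hC₃ = 0 := by
  have : Mono φ.τ₃ := hC₃.mono_f
  rw [← cancel_mono φ.τ₃, Category.assoc, p₁_comp, j₃_ιK_assoc, e₃_d₂, zero_comp]

/-- `C₁ ⟶ K ⟶ A₃ = 0`. [folklore] -/
private theorem j₁_p₃ (w : φ ≫ ψ = 0) (hR₁ : R₁.ShortExact) (hR₃ : R₃.ShortExact) :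
    j₁ φ ψ w hR₁ ≫ p₃ φ ψ w hR₃ = 0 := by
  have : Mono R₃.f := hR₃.mono_f
  rw [← cancel_mono R₃.f, Category.assoc, p₃_comp, j₁_ιK_assoc, e₁_d₃, zero_comp]

/-- **`K` is detected by `(p₁, p₃)`**: a morphism into `K` killed by both `K ⟶ C₁` and `K ⟶ A₃` is
zero (diagram chase by refinements; uses exactness of the middle column at `B₂` and of the first
row at `B₁`). [folklore] -/
private theorem ext_K (w : φ ≫ ψ = 0) (hR₁ : R₁.ShortExact) (hR₃ : R₃.ShortExact)
    (hC₂ : (col₂ φ ψ w).Exact) (hC₃ : (col₃ φ ψ w).ShortExact) {T : C} (x : T ⟶ K φ ψ)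
    (h₁ : x ≫ p₁ φ ψ w hC₃ = 0) (h₃ : x ≫ p₃ φ ψ w hR₃ = 0) : x = 0 := by
  have hx₂ : x ≫ ιK φ ψ ≫ d₂ φ = 0 := by
    rw [← p₁_comp φ ψ w hC₃, reassoc_of% h₁, zero_comp]
  have hx₃ : x ≫ ιK φ ψ ≫ d₃ φ ψ w = 0 := by
    rw [← p₃_comp φ ψ w hR₃, reassoc_of% h₃, zero_comp]
  -- lift `x ≫ ιK : T ⟶ D` along the epimorphism `B₂ ⟶ D`
  obtain ⟨T₁, π₁, _, y, hy⟩ := surjective_up_to_refinements_of_epi (πD φ) (x ≫ ιK φ ψ)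
  -- `y ⟶ B₂ ⟶ B₃` vanishes, so `y` comes from `B₁`
  have hy₃ : y ≫ (col₂ φ ψ w).g = 0 := by
    change y ≫ ψ.τ₂ = 0
    rw [← πD_d₃ φ ψ w, reassoc_of% hy.symm, hx₃, comp_zero]
  obtain ⟨T₂, π₂, _, z, hz⟩ := hC₂.exact_up_to_refinements y hy₃
  change π₂ ≫ y = z ≫ φ.τ₂ at hz
  -- `z ⟶ B₁ ⟶ C₁ ⟶ C₂` vanishes, so `z ⟶ C₁` vanishes and `z` comes from `A₁`
  have hz₃ : z ≫ R₁.g = 0 := by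
    have : Mono φ.τ₃ := hC₃.mono_f
    rw [← cancel_mono φ.τ₃, zero_comp, Category.assoc, ← φ.comm₂₃, reassoc_of% hz.symm,
      ← πD_d₂ φ, reassoc_of% hy.symm, hx₂, comp_zero, comp_zero]
  obtain ⟨T₃, π₃, _, v, hv⟩ := hR₁.exact.exact_up_to_refinements z hz₃
  -- hence `x ≫ ιK` vanishes after the three refinements, and so does `x`
  have hxι : (π₃ ≫ π₂ ≫ π₁ ≫ x) ≫ ιK φ ψ = 0 := by
    rw [Category.assoc, Category.assoc, Category.assoc, hy, reassoc_of% hz, reassoc_of% hv,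
      ← φ.comm₁₂_assoc, diag_πD, comp_zero]
  have h0 : π₃ ≫ π₂ ≫ π₁ ≫ x = 0 := zero_of_comp_mono _ hxι
  exact zero_of_epi_comp π₁ (zero_of_epi_comp π₂ (zero_of_epi_comp π₃ h0))

/-- **`K ≅ C₁ ⊞ A₃`**: `𝟙_K = p₁ ≫ j₁ + p₃ ≫ j₃`. [folklore] -/
private theorem id_K (w : φ ≫ ψ = 0) (hR₁ : R₁.ShortExact) (hR₃ : R₃.ShortExact)
    (hC₁ : (col₁ φ ψ w).ShortExact) (hC₂ : (col₂ φ ψ w).Exact) (hC₃ : (col₃ φ ψ w).ShortExact) :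
    𝟙 (K φ ψ) = p₁ φ ψ w hC₃ ≫ j₁ φ ψ w hR₁ + p₃ φ ψ w hR₃ ≫ j₃ φ ψ w hC₁ := by
  rw [← sub_eq_zero]
  apply ext_K φ ψ w hR₁ hR₃ hC₂ hC₃
  · rw [Preadditive.sub_comp, Preadditive.add_comp, Category.id_comp, Category.assoc,
      Category.assoc, j₁_p₁, j₃_p₁, Category.comp_id, comp_zero, add_zero, sub_self]
  · rw [Preadditive.sub_comp, Preadditive.add_comp, Category.id_comp, Category.assoc,
      Category.assoc, j₁_p₃, j₃_p₃, Category.comp_id, comp_zero, zero_add, sub_self]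

/-- The inclusion `K ⟶ D` through the two summands: `ιK = p₁ ≫ e₁ + p₃ ≫ e₃`. [folklore] -/
private theorem ιK_eq (w : φ ≫ ψ = 0) (hR₁ : R₁.ShortExact) (hR₃ : R₃.ShortExact)
    (hC₁ : (col₁ φ ψ w).ShortExact) (hC₂ : (col₂ φ ψ w).Exact) (hC₃ : (col₃ φ ψ w).ShortExact) :
    ιK φ ψ = p₁ φ ψ w hC₃ ≫ e₁ φ hR₁ + p₃ φ ψ w hR₃ ≫ e₃ φ ψ w hC₁ := by
  rw [← Category.id_comp (ιK φ ψ), id_K φ ψ w hR₁ hR₃ hC₁ hC₂ hC₃, Preadditive.add_comp,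
    Category.assoc, Category.assoc, j₁_ιK, j₃_ιK]

/-- **The `3 × 3` lemma, middle column**: if the rows are short exact, the outer columns short
exact and the columns are complexes (`φ ≫ ψ = 0`), then the middle column `B₁ ⟶ B₂ ⟶ B₃` is exact
at `B₂` (diagram chase by refinements; the cited exercise, part 3, with rows and columns interchanged).
[cite: Weibel1994, Exercise 1.3.2 (3) p. 11] -/
theorem col₂_exact (w : φ ≫ ψ = 0) (hR₁ : R₁.ShortExact) (hR₂ : R₂.ShortExact)
    (hR₃ : R₃.ShortExact) (hC₁ : (col₁ φ ψ w).ShortExact) (hC₃ : (col₃ φ ψ w).ShortExact) :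
    (col₂ φ ψ w).Exact := by
  have hw₂ : φ.τ₂ ≫ ψ.τ₂ = 0 := by rw [← ShortComplex.comp_τ₂, w, ShortComplex.zero_τ₂]
  rw [ShortComplex.exact_iff_exact_up_to_refinements]
  intro T y hy
  change y ≫ ψ.τ₂ = 0 at hy
  -- `y ≫ (B₂ ⟶ C₂)` dies in `C₃`, so it comes from `C₁`
  have h1 : (y ≫ R₂.g) ≫ (col₃ φ ψ w).g = 0 := by
    change (y ≫ R₂.g) ≫ ψ.τ₃ = 0
    rw [Category.assoc, ← ψ.comm₂₃, reassoc_of% hy, zero_comp]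
  obtain ⟨T₁, π₁, _, c, hc⟩ := hC₃.exact.exact_up_to_refinements (y ≫ R₂.g) h1
  change π₁ ≫ y ≫ R₂.g = c ≫ φ.τ₃ at hc
  -- lift `c` along the epimorphism `B₁ ⟶ C₁`
  have : Epi R₁.g := hR₁.epi_g
  obtain ⟨T₂, π₂, _, b, hb⟩ := surjective_up_to_refinements_of_epi R₁.g c
  -- `π₂ ≫ π₁ ≫ y - b ≫ (B₁ ⟶ B₂)` dies in `C₂`, so it comes from `A₂`
  have h2 : (π₂ ≫ π₁ ≫ y - b ≫ φ.τ₂) ≫ R₂.g = 0 := by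
    simp only [Preadditive.sub_comp, Category.assoc]
    rw [hc, reassoc_of% hb, φ.comm₂₃, sub_self]
  obtain ⟨T₃, π₃, _, a, ha⟩ := hR₂.exact.exact_up_to_refinements _ h2
  -- `a ≫ (A₂ ⟶ A₃)` dies in `B₃` (after the mono `A₃ ⟶ B₃`), so `a` comes from `A₁`
  have h3 : a ≫ (col₁ φ ψ w).g = 0 := by
    change a ≫ ψ.τ₁ = 0
    have : Mono R₃.f := hR₃.mono_f
    rw [← cancel_mono R₃.f, zero_comp, Category.assoc, ψ.comm₁₂, reassoc_of% ha.symm]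
    simp only [Preadditive.sub_comp, Category.assoc, hy, hw₂, comp_zero, sub_self]
  obtain ⟨T₄, π₄, _, a₁, ha₁⟩ := hC₁.exact.exact_up_to_refinements a h3
  change π₄ ≫ a = a₁ ≫ φ.τ₁ at ha₁
  have ha' : π₃ ≫ π₂ ≫ π₁ ≫ y = a ≫ R₂.f + π₃ ≫ b ≫ φ.τ₂ := by
    rw [← ha, Preadditive.comp_sub, sub_add_cancel]
  refine ⟨T₄, π₄ ≫ π₃ ≫ π₂ ≫ π₁, inferInstance, π₄ ≫ π₃ ≫ b + a₁ ≫ R₁.f, ?_⟩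
  change (π₄ ≫ π₃ ≫ π₂ ≫ π₁) ≫ y = (π₄ ≫ π₃ ≫ b + a₁ ≫ R₁.f) ≫ φ.τ₂
  simp only [Category.assoc, Preadditive.add_comp]
  rw [ha', Preadditive.comp_add, reassoc_of% ha₁, φ.comm₁₂, add_comm]

/-! ## §2 The `Ext` computation -/

/-- The short complex `A₁ ⟶ B₂ ⟶ D` (with `D = B₂ ⧸ A₁`). [folklore] -/
private noncomputable abbrev seqD : ShortComplex C :=
  ShortComplex.mk (diag φ) (πD φ) (cokernel.condition _)

/-- The short complex `K ⟶ D ⟶ C₃` (with `K = ker (D ⟶ C₃)`). [folklore] -/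
private noncomputable abbrev seqK : ShortComplex C :=
  ShortComplex.mk (ιK φ ψ) (q φ ψ) (kernel.condition _)

/-- `0 → A₁ → B₂ → D → 0` is short exact. [folklore] -/
private theorem shortExact_D (w : φ ≫ ψ = 0) (hR₂ : R₂.ShortExact) (hC₁ : (col₁ φ ψ w).ShortExact) :
    (seqD φ).ShortExact := by
  have : Mono φ.τ₁ := hC₁.mono_f
  have : Mono R₂.f := hR₂.mono_f
  have : Mono (diag φ) := mono_comp _ _
  exact ShortComplex.ShortExact.mk'
    (ShortComplex.cokernelSequence_exact (diag φ) : (seqD φ).Exact) this inferInstance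

/-- `0 → K → D → C₃ → 0` is short exact. [folklore] -/
private theorem shortExact_K (w : φ ≫ ψ = 0) (hR₂ : R₂.ShortExact) (hC₃ : (col₃ φ ψ w).ShortExact) :
    (seqK φ ψ).ShortExact := by
  have : Epi R₂.g := hR₂.epi_g
  have : Epi ψ.τ₃ := hC₃.epi_g
  have : Epi (πD φ ≫ q φ ψ) := by rw [πD_q]; exact epi_comp _ _
  have : Epi (q φ ψ) := epi_of_epi (πD φ) _
  exact ShortComplex.ShortExact.mk'
    (ShortComplex.kernelSequence_exact (q φ ψ) : (seqK φ ψ).Exact) inferInstance this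

section Ext

variable [HasExt.{w} C]

/-- `e₁^* [A₁ ↪ B₂ ↠ D] = [R₁]` (naturality along `R₁ ⟶ (A₁ ↪ B₂ ↠ D)`). [folklore] -/
private theorem mk₀_e₁_comp_extClass_D (w : φ ≫ ψ = 0) (hR₁ : R₁.ShortExact) (hR₂ : R₂.ShortExact)
    (hC₁ : (col₁ φ ψ w).ShortExact) :
    (Ext.mk₀ (e₁ φ hR₁)).comp (shortExact_D φ ψ w hR₂ hC₁).extClass (zero_add 1) =
      hR₁.extClass := by
  have h := ShortComplex.ShortExact.extClass_naturality hR₁ (shortExact_D φ ψ w hR₂ hC₁)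
    (ShortComplex.homMk (𝟙 _) φ.τ₂ (e₁ φ hR₁)
      (show 𝟙 _ ≫ φ.τ₁ ≫ R₂.f = R₁.f ≫ φ.τ₂ by rw [Category.id_comp, φ.comm₁₂])
      (comp_e₁ φ hR₁).symm)
  rw [ShortComplex.homMk_τ₁, ShortComplex.homMk_τ₃, Ext.comp_mk₀_id] at h
  exact h.symm

/-- `e₃^* [A₁ ↪ B₂ ↠ D] = [col₁]` (naturality along `col₁ ⟶ (A₁ ↪ B₂ ↠ D)`). [folklore] -/
private theorem mk₀_e₃_comp_extClass_D (w : φ ≫ ψ = 0) (hR₂ : R₂.ShortExact)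
    (hC₁ : (col₁ φ ψ w).ShortExact) :
    (Ext.mk₀ (e₃ φ ψ w hC₁)).comp (shortExact_D φ ψ w hR₂ hC₁).extClass (zero_add 1) =
      hC₁.extClass := by
  have h := ShortComplex.ShortExact.extClass_naturality hC₁ (shortExact_D φ ψ w hR₂ hC₁)
    (ShortComplex.homMk (𝟙 _) R₂.f (e₃ φ ψ w hC₁) (Category.id_comp _) (comp_e₃ φ ψ w hC₁).symm)
  rw [ShortComplex.homMk_τ₁, ShortComplex.homMk_τ₃, Ext.comp_mk₀_id] at h
  exact h.symm

/-- `(p₁)_* [K ↪ D ↠ C₃] = [col₃]` (naturality along `(K ↪ D ↠ C₃) ⟶ col₃`). [folklore] -/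
private theorem extClass_K_comp_mk₀_p₁ (w : φ ≫ ψ = 0) (hR₂ : R₂.ShortExact)
    (hC₃ : (col₃ φ ψ w).ShortExact) :
    (shortExact_K φ ψ w hR₂ hC₃).extClass.comp (Ext.mk₀ (p₁ φ ψ w hC₃)) (add_zero 1) =
      hC₃.extClass := by
  have h := ShortComplex.ShortExact.extClass_naturality (shortExact_K φ ψ w hR₂ hC₃) hC₃
    (ShortComplex.homMk (p₁ φ ψ w hC₃) (d₂ φ) (𝟙 _) (p₁_comp φ ψ w hC₃)
      (show d₂ φ ≫ ψ.τ₃ = q φ ψ ≫ 𝟙 _ by rw [Category.comp_id, d₂_comp]))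
  rw [ShortComplex.homMk_τ₁, ShortComplex.homMk_τ₃, Ext.mk₀_id_comp] at h
  exact h

/-- `(p₃)_* [K ↪ D ↠ C₃] = [R₃]` (naturality along `(K ↪ D ↠ C₃) ⟶ R₃`). [folklore] -/
private theorem extClass_K_comp_mk₀_p₃ (w : φ ≫ ψ = 0) (hR₂ : R₂.ShortExact) (hR₃ : R₃.ShortExact)
    (hC₃ : (col₃ φ ψ w).ShortExact) :
    (shortExact_K φ ψ w hR₂ hC₃).extClass.comp (Ext.mk₀ (p₃ φ ψ w hR₃)) (add_zero 1) =
      hR₃.extClass := by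
  have h := ShortComplex.ShortExact.extClass_naturality (shortExact_K φ ψ w hR₂ hC₃) hR₃
    (ShortComplex.homMk (p₃ φ ψ w hR₃) (d₃ φ ψ w) (𝟙 _) (p₃_comp φ ψ w hR₃)
      (show d₃ φ ψ w ≫ R₃.g = q φ ψ ≫ 𝟙 _ by rw [Category.comp_id, d₃_comp]))
  rw [ShortComplex.homMk_τ₁, ShortComplex.homMk_τ₃, Ext.mk₀_id_comp] at h
  exact h

/-- `[K ↪ D ↠ C₃]` followed by the inclusion `K ⟶ D` is zero (two consecutive maps of the long exact
sequence), hence so is `[K ↪ D ↠ C₃] ∘ ιK ∘ [A₁ ↪ B₂ ↠ D]` in `Ext²(C₃, A₁)`. [folklore] -/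
private theorem extClass_K_comp_ιK_comp_extClass_D (w : φ ≫ ψ = 0) (hR₂ : R₂.ShortExact)
    (hC₁ : (col₁ φ ψ w).ShortExact) (hC₃ : (col₃ φ ψ w).ShortExact) {n : ℕ} (h : 1 + 1 = n) :
    (shortExact_K φ ψ w hR₂ hC₃).extClass.comp
      ((Ext.mk₀ (ιK φ ψ)).comp (shortExact_D φ ψ w hR₂ hC₁).extClass (zero_add 1)) h = 0 := by
  rw [← Ext.comp_assoc_of_second_deg_zero,
    (shortExact_K φ ψ w hR₂ hC₃).extClass_comp, Ext.zero_comp]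

/-- The inclusion `K ⟶ D` in degree-`0` `Ext`, through the two summands. [folklore] -/
private theorem mk₀_ιK_eq (w : φ ≫ ψ = 0) (hR₁ : R₁.ShortExact) (hR₃ : R₃.ShortExact)
    (hC₁ : (col₁ φ ψ w).ShortExact) (hC₂ : (col₂ φ ψ w).Exact) (hC₃ : (col₃ φ ψ w).ShortExact) :
    Ext.mk₀ (ιK φ ψ) =
      (Ext.mk₀ (p₁ φ ψ w hC₃)).comp (Ext.mk₀ (e₁ φ hR₁)) (zero_add 0) +
        (Ext.mk₀ (p₃ φ ψ w hR₃)).comp (Ext.mk₀ (e₃ φ ψ w hC₁)) (zero_add 0) := by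
  rw [Ext.mk₀_comp_mk₀, Ext.mk₀_comp_mk₀, ← Ext.mk₀_add, ← ιK_eq φ ψ w hR₁ hR₃ hC₁ hC₂ hC₃]

/-- **The two composite connecting classes of a `3 × 3` diagram anticommute** (sum form): for a
commutative diagram of short complexes `φ : R₁ ⟶ R₂`, `ψ : R₂ ⟶ R₃`, `φ ≫ ψ = 0`, with short exact
rows and short exact outer columns (the middle column is then exact, `col₂_exact`),
`[col₃] ∘ [R₁] + [R₃] ∘ [col₁] = 0` in `Ext²(C₃, A₁)` (`Ext.comp` diagrammatic; stated in every
degree `n` with a proof of `1 + 1 = n`). [cite: CartanEilenberg1956, Ch. III §4 Prop. 4.1 pp. 44–45] -/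
theorem extClass_comp_extClass_add_eq_zero (w : φ ≫ ψ = 0) (hR₁ : R₁.ShortExact)
    (hR₂ : R₂.ShortExact) (hR₃ : R₃.ShortExact) (hC₁ : (col₁ φ ψ w).ShortExact)
    (hC₃ : (col₃ φ ψ w).ShortExact) {n : ℕ} (h : 1 + 1 = n) :
    hC₃.extClass.comp hR₁.extClass h + hR₃.extClass.comp hC₁.extClass h = 0 := by
  have h0 := extClass_K_comp_ιK_comp_extClass_D φ ψ w hR₂ hC₁ hC₃ h
  rw [mk₀_ιK_eq φ ψ w hR₁ hR₃ hC₁ (col₂_exact φ ψ w hR₁ hR₂ hR₃ hC₁ hC₃) hC₃, Ext.add_comp, Ext.comp_assoc_of_second_deg_zero,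
    Ext.comp_assoc_of_second_deg_zero, mk₀_e₁_comp_extClass_D φ ψ w hR₁ hR₂ hC₁,
    mk₀_e₃_comp_extClass_D φ ψ w hR₂ hC₁, Ext.comp_add, ← Ext.comp_assoc_of_second_deg_zero,
    ← Ext.comp_assoc_of_second_deg_zero, extClass_K_comp_mk₀_p₁ φ ψ w hR₂ hC₃,
    extClass_K_comp_mk₀_p₃ φ ψ w hR₂ hR₃ hC₃] at h0
  exact h0

/-- **The two composite connecting classes of a `3 × 3` diagram differ in sign**:
`[col₃] ∘ [R₁] = −[R₃] ∘ [col₁]` in `Ext²(C₃, A₁)`.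
[cite: CartanEilenberg1956, Ch. III §4 Prop. 4.1 pp. 44–45] -/
theorem extClass_comp_extClass_eq_neg (w : φ ≫ ψ = 0) (hR₁ : R₁.ShortExact)
    (hR₂ : R₂.ShortExact) (hR₃ : R₃.ShortExact) (hC₁ : (col₁ φ ψ w).ShortExact)
    (hC₃ : (col₃ φ ψ w).ShortExact) {n : ℕ} (h : 1 + 1 = n) :
    hC₃.extClass.comp hR₁.extClass h = -hR₃.extClass.comp hC₁.extClass h :=
  eq_neg_of_add_eq_zero_left
    (extClass_comp_extClass_add_eq_zero φ ψ w hR₁ hR₂ hR₃ hC₁ hC₃ h)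

/-- The same with the sign written as the unit `−1 ∈ ℤˣ` acting on `Ext` (the shape in which a
sign `ε : ℤˣ` is carried by users of such squares).
[cite: CartanEilenberg1956, Ch. III §4 Prop. 4.1 pp. 44–45] -/
theorem extClass_comp_extClass_eq_units_smul (w : φ ≫ ψ = 0) (hR₁ : R₁.ShortExact)
    (hR₂ : R₂.ShortExact) (hR₃ : R₃.ShortExact) (hC₁ : (col₁ φ ψ w).ShortExact)
    (hC₃ : (col₃ φ ψ w).ShortExact) {n : ℕ} (h : 1 + 1 = n) :
    hC₃.extClass.comp hR₁.extClass h = ((-1 : ℤˣ) : ℤ) • hR₃.extClass.comp hC₁.extClass h := by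
  rw [Units.val_neg, Units.val_one, neg_one_zsmul]
  exact extClass_comp_extClass_eq_neg φ ψ w hR₁ hR₂ hR₃ hC₁ hC₃ h

end Ext

end NineDiagram

end Literature.Algebra.Homology
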